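import Literature.Probability.RandomPlanarGeometry.ImageUnivalent
import Literature.Topology.PlaneTopology.Brouwer
import Mathlib.Topology.MetricSpace.HausdorffDistance
import HarnessLib

/-!
# Continua crossing a perturbed rectangle contain a crossing of it

Topic: Topology / PlaneTopology.  The planar crossing lemma behind Schramm–Smirnov's condition
`(3.2)` for quads ("a quad `Q₀` can be easily approximated by smaller quads", *On the scaling
limits of planar percolation* (2011), §3 p. 1781, and the quads `Q' < Q₀ < Q''` in the proof of
Lemma 5.1): after straightening the quad by a homeomorphism of the plane
(`CellSchoenflies.lean`) one must show that **every continuum joining the two vertical sides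
of a slightly perturbed square contains a continuum joining the two vertical sides of a
slightly perturbed taller-and-narrower rectangle, inside that rectangle**.  Rectangles are
`[-a, a] × [-b, b] = Icc (-a) a ×ℂ Icc (-b) b`.  We prove:

* `exists_isClopen_superset_disjoint` / `exists_closed_separation` — the **cut-wire theorem**
  (Šura-Bura; Kuratowski, *Topology* II §47.II): in a compact Hausdorff space, if no connected
  set meets both of two closed sets `A`, `B`, then some clopen set contains `A` and misses `B`
  (components are intersections of clopen sets, `connectedComponent_eq_iInter_isClopen`, plus
  compactness);
* `exists_retraction_rect` — the coordinatewise clamp onto a closed rectangle;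
* `mem_image_of_norm_sub_le` — the **band lemma**: if `g` is continuous on the closed rectangle
  with `‖g z - z‖ ≤ η` there, then every point `w` with `|Re w| ≤ a - η₁`, `|Im w| ≤ b - η₁`,
  `η < η₁`, lies in the image (extend `g` by the retraction and a cut-off to a map of a large
  disc fixing its boundary circle and apply `closedBall_subset_image`, the no-retraction form of
  Brouwer's fixed point theorem from `Brouwer.lean`);
* `mem_image_frontier_of_mem_closure_compl` — a point of the embedded closed rectangle in the
  closure of its complement lies on the image of the boundary of the rectangle (invariance of
  domain, `frontier_image_of_isBounded` of `ImageUnivalent.lean`);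
* `exists_subcontinuum_crossing` — the **crossing lemma**: for `0 < s ≤ 1/2`, `0 < η`, `4η < s`
  and `g` a continuous injection of `R̄ₛ = [-(1-s), 1-s] × [-(1+s), 1+s]` with `‖g z - z‖ ≤ η`,
  every continuum `K ⊆ {|Im| ≤ 1 + η}` containing points with `Re ≤ -1 + η` and with
  `Re ≥ 1 - η` contains a continuum `K' ⊆ g(R̄ₛ)` meeting the images of both vertical sides of
  `R̄ₛ`.  Proof: the band lemma puts the middle band inside `g(R̄ₛ)`, so `K ∖ g(R̄ₛ)` splits into
  a far-left and a far-right part; a point of `g(R̄ₛ)` in the closure of the left part is on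
  `g(∂Rₛ)`, hence on the image of the left side; if no connected subset of `K ∩ g(R̄ₛ)` met both
  side images, the cut-wire theorem would split `K ∩ g(R̄ₛ)` compatibly and `K` would be
  disconnected.

## References

* O. Schramm, S. Smirnov, *On the scaling limits of planar percolation*, Ann. Probab. 39 (2011),
  §3 (3.2) and proof of Lemma 5.1. [SchrammSmirnov2011]
* K. Kuratowski, *Topology* II (1968), §47.II Thm. 3 (cut-wire / Šura-Bura theorem).
-/

noncomputable section

namespace Literature.Topology.PlaneTopology

open Complex Set Metric Filter Function _root_.Topology
open Literature.Probability.RandomPlanarGeometry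

/-! ### The cut-wire theorem -/

/-- **Cut-wire theorem** (Šura-Bura): in a compact Hausdorff space, if the component of every
point of the closed set `A` misses the closed set `B`, then some clopen set contains `A` and
misses `B`.  (Each component is the intersection of the clopen sets containing it; by
compactness of `B` finitely many of them already miss `B`; cover `A` by finitely many such
clopen sets.) [folklore] -/
theorem exists_isClopen_superset_disjoint {X : Type*} [TopologicalSpace X] [CompactSpace X]
    [T2Space X] {A B : Set X} (hA : IsClosed A) (hB : IsClosed B)
    (h : ∀ x ∈ A, Disjoint (connectedComponent x) B) :
    ∃ U : Set X, IsClopen U ∧ A ⊆ U ∧ Disjoint U B := by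
  classical
  have key : ∀ x ∈ A, ∃ W : Set X, IsClopen W ∧ x ∈ W ∧ Disjoint W B := by
    intro x hx
    have hcomp : connectedComponent x = ⋂ Z : {Z : Set X // IsClopen Z ∧ x ∈ Z}, (Z : Set X) :=
      connectedComponent_eq_iInter_isClopen x
    have hint : B ∩ ⋂ Z : {Z : Set X // IsClopen Z ∧ x ∈ Z}, (Z : Set X) = ∅ := by
      rw [← hcomp, inter_comm]
      exact (h x hx).inter_eq
    obtain ⟨F, hF⟩ := hB.isCompact.elim_finite_subfamily_closed
      (fun Z : {Z : Set X // IsClopen Z ∧ x ∈ Z} => (Z : Set X)) (fun Z => Z.2.1.isClosed) hint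
    refine ⟨⋂ Z ∈ F, (Z : Set X), isClopen_biInter_finset fun Z _ => Z.2.1,
      mem_iInter₂.2 fun Z _ => Z.2.2, ?_⟩
    rw [Set.disjoint_iff_inter_eq_empty, inter_comm]
    exact hF
  choose! W hWc hxW hWB using key
  obtain ⟨t, ht⟩ := hA.isCompact.elim_finite_subcover (fun x : A => W x)
    (fun x => (hWc x x.2).isOpen) fun x hx => mem_iUnion.2 ⟨⟨x, hx⟩, hxW x hx⟩
  refine ⟨⋃ x ∈ t, W x, isClopen_biUnion_finset fun x _ => hWc x x.2, ht, ?_⟩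
  rw [disjoint_iUnion₂_left]
  exact fun x _ => hWB x x.2

/-- **Cut-wire theorem for a compact subset of a Hausdorff space**: if no preconnected subset
of the compact set `Z` meets both closed sets `A` and `B`, then `Z` is the disjoint union of two
closed sets `Z₁`, `Z₂` with `Z₁` missing `B` and `Z₂` missing `A`. [folklore] -/
theorem exists_closed_separation {Y : Type*} [TopologicalSpace Y] [T2Space Y] {Z A B : Set Y}
    (hZ : IsCompact Z) (hA : IsClosed A) (hB : IsClosed B)
    (h : ∀ C ⊆ Z, IsPreconnected C → (C ∩ A).Nonempty → (C ∩ B).Nonempty → False) :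
    ∃ Z₁ Z₂ : Set Y, IsClosed Z₁ ∧ IsClosed Z₂ ∧ Disjoint Z₁ Z₂ ∧ Z₁ ∪ Z₂ = Z ∧
      Disjoint Z₁ B ∧ Disjoint Z₂ A := by
  haveI : CompactSpace Z := isCompact_iff_compactSpace.1 hZ
  set A' : Set Z := ((↑) : Z → Y) ⁻¹' A with hA'
  set B' : Set Z := ((↑) : Z → Y) ⁻¹' B with hB'
  have hA'c : IsClosed A' := hA.preimage continuous_subtype_val
  have hB'c : IsClosed B' := hB.preimage continuous_subtype_val
  have hdisj : ∀ x ∈ A', Disjoint (connectedComponent x) B' := by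
    intro x hx
    rw [Set.disjoint_left]
    intro y hy hyB
    refine h (((↑) : Z → Y) '' connectedComponent x) (by simp)
      (isPreconnected_connectedComponent.image _ continuous_subtype_val.continuousOn)
      ⟨x, ⟨x, mem_connectedComponent, rfl⟩, hx⟩ ⟨y, ⟨y, hy, rfl⟩, hyB⟩
  obtain ⟨U, hU, hAU, hUB⟩ := exists_isClopen_superset_disjoint hA'c hB'c hdisj
  refine ⟨((↑) : Z → Y) '' U, ((↑) : Z → Y) '' Uᶜ,
    (hU.isClosed.isCompact.image continuous_subtype_val).isClosed,
    (hU.compl.isClosed.isCompact.image continuous_subtype_val).isClosed, ?_, ?_, ?_, ?_⟩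
  · exact (disjoint_image_iff Subtype.val_injective).2 disjoint_compl_right
  · rw [← image_union, union_compl_self, image_univ, Subtype.range_coe]
  · rw [Set.disjoint_left]
    rintro _ ⟨u, hu, rfl⟩ huB
    exact Set.disjoint_left.1 hUB hu huB
  · rw [Set.disjoint_left]
    rintro _ ⟨u, hu, rfl⟩ huA
    exact hu (hAU huA)

/-! ### Closed rectangles: coordinates, retraction, compactness -/

variable {a b : ℝ}

/-- Coordinates of points of the closed rectangle `[-a, a] × [-b, b]`. [folklore] -/
theorem abs_re_le_of_mem_rect {z : ℂ} (hz : z ∈ Icc (-a) a ×ℂ Icc (-b) b) :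
    |z.re| ≤ a ∧ |z.im| ≤ b := by
  rw [mem_reProdIm, mem_Icc, mem_Icc] at hz
  exact ⟨abs_le.2 hz.1, abs_le.2 hz.2⟩

/-- Membership in the closed rectangle from bounds on the coordinates. [folklore] -/
theorem mem_rect_of_abs_le {z : ℂ} (hre : |z.re| ≤ a) (him : |z.im| ≤ b) :
    z ∈ Icc (-a) a ×ℂ Icc (-b) b := by
  rw [mem_reProdIm, mem_Icc, mem_Icc]
  exact ⟨abs_le.1 hre, abs_le.1 him⟩

/-- If `‖g z - z‖ ≤ η` then the coordinates of `g z` and `z` differ by at most `η`. [folklore] -/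
theorem abs_re_sub_le_of_norm_sub_le {g : ℂ → ℂ} {z : ℂ} {η : ℝ} (h : ‖g z - z‖ ≤ η) :
    |(g z).re - z.re| ≤ η ∧ |(g z).im - z.im| ≤ η :=
  ⟨by simpa only [sub_re] using (abs_re_le_norm (g z - z)).trans h,
    by simpa only [sub_im] using (abs_im_le_norm (g z - z)).trans h⟩

/-- The closed rectangle is compact. [folklore] -/
theorem isCompact_rect (a b : ℝ) : IsCompact (Icc (-a) a ×ℂ Icc (-b) b) :=
  Metric.isCompact_of_isClosed_isBounded (isClosed_Icc.reProdIm isClosed_Icc)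
    ((isBounded_Icc _ _).reProdIm (isBounded_Icc _ _))

/-- The closed rectangle is the closure of the open one. [folklore] -/
theorem closure_Ioo_reProdIm_Ioo (ha : 0 < a) (hb : 0 < b) :
    closure (Ioo (-a) a ×ℂ Ioo (-b) b) = Icc (-a) a ×ℂ Icc (-b) b := by
  rw [closure_reProdIm, closure_Ioo (by linarith), closure_Ioo (by linarith)]

/-- The frontier of the open rectangle: the four closed sides. [folklore] -/
theorem mem_frontier_Ioo_reProdIm_Ioo (ha : 0 < a) (hb : 0 < b) {z : ℂ} :
    z ∈ frontier (Ioo (-a) a ×ℂ Ioo (-b) b) ↔ ((-a ≤ z.re ∧ z.re ≤ a) ∧ (z.im = -b ∨ z.im = b)) ∨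
      ((z.re = -a ∨ z.re = a) ∧ (-b ≤ z.im ∧ z.im ≤ b)) := by
  rw [frontier_reProdIm, closure_Ioo (by linarith), closure_Ioo (by linarith),
    frontier_Ioo (by linarith), frontier_Ioo (by linarith), mem_union, mem_reProdIm,
    mem_reProdIm]
  simp only [mem_Icc, mem_insert_iff, mem_singleton_iff]

/-- The coordinatewise clamp is a continuous retraction of `ℂ` onto the closed rectangle
`[-a, a] × [-b, b]`. [folklore] -/
theorem exists_retraction_rect (ha : 0 < a) (hb : 0 < b) :
    ∃ π : ℂ → ℂ, Continuous π ∧ (∀ z, π z ∈ Icc (-a) a ×ℂ Icc (-b) b) ∧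
      ∀ z ∈ Icc (-a) a ×ℂ Icc (-b) b, π z = z := by
  have ha' : -a ≤ a := by linarith
  have hb' : -b ≤ b := by linarith
  refine ⟨fun z => ((projIcc (-a) a ha' z.re : ℝ) : ℂ) + ((projIcc (-b) b hb' z.im : ℝ) : ℂ) * I,
    ?_, fun z => ?_, fun z hz => ?_⟩
  · exact (continuous_ofReal.comp (continuous_subtype_val.comp
      (continuous_projIcc.comp continuous_re))).add
      ((continuous_ofReal.comp (continuous_subtype_val.comp
        (continuous_projIcc.comp continuous_im))).mul continuous_const)
  · rw [mem_reProdIm]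
    have h1 := (projIcc (-a) a ha' z.re).2
    have h2 := (projIcc (-b) b hb' z.im).2
    simp only [add_re, ofReal_re, mul_re, I_re, mul_zero, ofReal_im, I_im, mul_one, sub_self,
      add_zero, add_im, mul_im, zero_add]
    exact ⟨h1, h2⟩
  · rw [mem_reProdIm] at hz
    apply Complex.ext
    · simp [projIcc_of_mem ha' hz.1]
    · simp [projIcc_of_mem hb' hz.2]

/-! ### The band lemma -/

/-- **Band lemma**: if `g` is continuous on `R̄ = [-a, a] × [-b, b]` and moves no point of `R̄`
by more than `η`, then every point `w` with `|Re w| ≤ a - η₁`, `|Im w| ≤ b - η₁` (`η < η₁`)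
lies in `g(R̄)`.  Proof: `G z = z + χ(z) (g(π z) - π z)` (`π` the retraction onto `R̄`, `χ` a
cut-off equal to `1` on `R̄` and `0` far away) is a continuous map of a large closed disc fixing
its boundary circle, so its image contains the disc (`closedBall_subset_image`, Brouwer); if
`w = G z` with `z ∉ R̄` then `‖w - z‖ ≤ η` while some coordinate of `z` differs from that of `w`
by more than `η₁`. [folklore] -/
theorem mem_image_of_norm_sub_le (ha : 0 < a) (hb : 0 < b) {g : ℂ → ℂ}
    (hg : ContinuousOn g (Icc (-a) a ×ℂ Icc (-b) b)) {η η₁ : ℝ}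
    (hgη : ∀ z ∈ Icc (-a) a ×ℂ Icc (-b) b, ‖g z - z‖ ≤ η) (hη₁ : η < η₁) {w : ℂ}
    (hre : |w.re| ≤ a - η₁) (him : |w.im| ≤ b - η₁) : w ∈ g '' (Icc (-a) a ×ℂ Icc (-b) b) := by
  obtain ⟨π, hπc, hπmem, hπid⟩ := exists_retraction_rect ha hb
  set S := Icc (-a) a ×ℂ Icc (-b) b with hS
  have hη0 : 0 ≤ η := (norm_nonneg _).trans (hgη (π 0) (hπmem 0))
  -- the cut-off
  set χ : ℂ → ℝ := fun z => max 0 (1 - infDist z S) with hχ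
  have hχc : Continuous χ := continuous_const.max (continuous_const.sub (continuous_infDist_pt S))
  have hχ0 : ∀ z, 0 ≤ χ z := fun z => le_max_left _ _
  have hχ1 : ∀ z, χ z ≤ 1 := fun z =>
    max_le zero_le_one (sub_le_self _ infDist_nonneg)
  have hχS : ∀ z ∈ S, χ z = 1 := fun z hz => by
    simp [hχ, infDist_zero_of_mem hz]
  have hχfar : ∀ z, 1 ≤ infDist z S → χ z = 0 := fun z hz =>
    max_eq_left (by linarith)
  -- the extension `G`
  set G : ℂ → ℂ := fun z => z + (χ z : ℂ) * (g (π z) - π z) with hG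
  have hGc : Continuous G := by
    have h1 : Continuous fun z => g (π z) := hg.comp_continuous hπc hπmem
    exact continuous_id.add ((continuous_ofReal.comp hχc).mul (h1.sub hπc))
  have hGS : ∀ z ∈ S, G z = g z := fun z hz => by
    show z + (χ z : ℂ) * (g (π z) - π z) = g z
    rw [hπid z hz, hχS z hz]
    push_cast
    ring
  have hGη : ∀ z, ‖G z - z‖ ≤ η := fun z => by
    have : G z - z = (χ z : ℂ) * (g (π z) - π z) := by simp only [hG]; ring
    rw [this, norm_mul, norm_real, Real.norm_eq_abs, abs_of_nonneg (hχ0 z)]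
    calc χ z * ‖g (π z) - π z‖ ≤ 1 * ‖g (π z) - π z‖ :=
          mul_le_mul_of_nonneg_right (hχ1 z) (norm_nonneg _)
      _ ≤ η := by rw [one_mul]; exact hgη _ (hπmem z)
  -- `R̄` lies in the disc of radius `a + b`
  have hSball : ∀ u ∈ S, ‖u‖ ≤ a + b := fun u hu => by
    obtain ⟨h1, h2⟩ := abs_re_le_of_mem_rect hu
    calc ‖u‖ ≤ |u.re| + |u.im| := norm_le_abs_re_add_abs_im u
      _ ≤ a + b := add_le_add h1 h2
  set ρ : ℝ := a + b + 1 with hρ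
  have hfix : ∀ z : ℂ, ‖z - 0‖ = ρ → G z = z := by
    intro z hz
    rw [sub_zero] at hz
    have hfar : 1 ≤ infDist z S := by
      refine (le_infDist ⟨π 0, hπmem 0⟩).2 fun u hu => ?_
      rw [dist_eq_norm]
      have := norm_sub_norm_le z u
      linarith [hSball u hu]
    simp only [hG, hχfar z hfar, ofReal_zero, zero_mul, add_zero]
  have hwball : w ∈ closedBall (0 : ℂ) ρ := by
    rw [mem_closedBall, dist_zero_right]
    calc ‖w‖ ≤ |w.re| + |w.im| := norm_le_abs_re_add_abs_im w
      _ ≤ ρ := by linarith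
  obtain ⟨z, -, hzw⟩ := closedBall_subset_image hGc.continuousOn hfix hwball
  by_cases hzS : z ∈ S
  · exact ⟨z, hzS, (hGS z hzS).symm.trans hzw⟩
  · exfalso
    have hclose : ‖w - z‖ ≤ η := by rw [← hzw]; exact hGη z
    have hre' : |w.re - z.re| ≤ η := by
      simpa only [sub_re] using (abs_re_le_norm (w - z)).trans hclose
    have him' : |w.im - z.im| ≤ η := by
      simpa only [sub_im] using (abs_im_le_norm (w - z)).trans hclose
    rw [hS, mem_reProdIm, mem_Icc, mem_Icc] at hzS
    rw [abs_le] at hre him hre' him'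
    by_cases h1 : -a ≤ z.re ∧ z.re ≤ a
    · have h2 : ¬(-b ≤ z.im ∧ z.im ≤ b) := fun h2 => hzS ⟨h1, h2⟩
      rcases not_and_or.1 h2 with h3 | h3 <;> push Not at h3 <;> linarith
    · rcases not_and_or.1 h1 with h3 | h3 <;> push Not at h3 <;> linarith

/-! ### Embedded rectangles: frontier points -/

/-- A point of the image of the closed rectangle under a continuous injection, which is a limit
of points off that image, lies on the image of the boundary of the rectangle (invariance of
domain: the image of the open rectangle is open with frontier the image of its frontier,
`frontier_image_of_isBounded`). [folklore] -/
theorem mem_image_frontier_of_mem_closure_compl (ha : 0 < a) (hb : 0 < b) {g : ℂ → ℂ}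
    (hgc : ContinuousOn g (Icc (-a) a ×ℂ Icc (-b) b)) (hgi : InjOn g (Icc (-a) a ×ℂ Icc (-b) b))
    {z : ℂ} (hz : z ∈ g '' (Icc (-a) a ×ℂ Icc (-b) b))
    (hz' : z ∈ closure (g '' (Icc (-a) a ×ℂ Icc (-b) b))ᶜ) :
    z ∈ g '' frontier (Ioo (-a) a ×ℂ Ioo (-b) b) := by
  set R := Ioo (-a) a ×ℂ Ioo (-b) b with hR
  have hcl : closure R = Icc (-a) a ×ℂ Icc (-b) b := closure_Ioo_reProdIm_Ioo ha hb
  rw [← hcl] at hgc hgi hz hz'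
  have hRb : Bornology.IsBounded R := (isBounded_Ioo _ _).reProdIm (isBounded_Ioo _ _)
  have hRo : IsOpen R := isOpen_Ioo.reProdIm isOpen_Ioo
  have hclimg : closure (g '' R) = g '' closure R := closure_image_of_isBounded hRb hgc
  have hzfr : z ∈ frontier (g '' closure R) := by
    rw [frontier_eq_closure_inter_closure]
    exact ⟨subset_closure hz, hz'⟩
  rw [← hclimg] at hzfr
  rw [← frontier_image_of_isBounded hRb hRo hgc hgi]
  exact frontier_closure_subset hzfr

/-! ### The crossing lemma -/

/-- **The crossing lemma.** Let `s ≤ 1/2`, `0 < η`, `4η < s` (so `0 < s`), and let `g` be a continuous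
injection of the closed rectangle `R̄ₛ = [-(1-s), 1-s] × [-(1+s), 1+s]` into `ℂ` moving no point
by more than `η`.  Then every continuum `K ⊆ {|Im| ≤ 1 + η}` which contains a point with
`Re ≤ -1 + η` and a point with `Re ≥ 1 - η` contains a continuum `K' ⊆ g(R̄ₛ)` meeting the
images under `g` of both vertical sides of `R̄ₛ` — i.e. `K` contains a crossing of the
(perturbed, taller and narrower) rectangle `g(R̄ₛ)`.  This is the geometric content of
Schramm–Smirnov's "`Q' < Q₀`" for `Q' = Q^{q}`, `q = (s, -s, 1 - s, 1 + s)` (proof of Lemma 5.1).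
[cite: SchrammSmirnov2011, §3 (3.2) and proof of Lemma 5.1] -/
theorem exists_subcontinuum_crossing {s η : ℝ} (hs' : s ≤ 1 / 2) (hη : 0 < η)
    (hηs : 4 * η < s) {g : ℂ → ℂ}
    (hgc : ContinuousOn g (Icc (-(1 - s)) (1 - s) ×ℂ Icc (-(1 + s)) (1 + s)))
    (hgi : InjOn g (Icc (-(1 - s)) (1 - s) ×ℂ Icc (-(1 + s)) (1 + s)))
    (hgη : ∀ z ∈ Icc (-(1 - s)) (1 - s) ×ℂ Icc (-(1 + s)) (1 + s), ‖g z - z‖ ≤ η)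
    {K : Set ℂ} (hKc : IsCompact K) (hKconn : IsConnected K)
    (hKim : ∀ w ∈ K, |w.im| ≤ 1 + η) (hK₀ : ∃ w ∈ K, w.re ≤ -1 + η)
    (hK₂ : ∃ w ∈ K, 1 - η ≤ w.re) :
    ∃ K' ⊆ K, IsCompact K' ∧ IsConnected K' ∧
      K' ⊆ g '' (Icc (-(1 - s)) (1 - s) ×ℂ Icc (-(1 + s)) (1 + s)) ∧
      (K' ∩ g '' {z | z ∈ Icc (-(1 - s)) (1 - s) ×ℂ Icc (-(1 + s)) (1 + s) ∧
        z.re = -(1 - s)}).Nonempty ∧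
      (K' ∩ g '' {z | z ∈ Icc (-(1 - s)) (1 - s) ×ℂ Icc (-(1 + s)) (1 + s) ∧
        z.re = 1 - s}).Nonempty := by
  have ha : (0 : ℝ) < 1 - s := by linarith
  have hb : (0 : ℝ) < 1 + s := by linarith
  set R := Icc (-(1 - s)) (1 - s) ×ℂ Icc (-(1 + s)) (1 + s) with hR
  set Rimg := g '' R with hRimg
  set Lside := g '' {z | z ∈ R ∧ z.re = -(1 - s)} with hLside
  set Rside := g '' {z | z ∈ R ∧ z.re = 1 - s} with hRside
  have hRcpt : IsCompact R := isCompact_rect _ _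
  have hRimg_cpt : IsCompact Rimg := hRcpt.image_of_continuousOn hgc
  have hRimg_closed : IsClosed Rimg := hRimg_cpt.isClosed
  -- the two vertical sides and their images are compact
  have hside_closed : ∀ c : ℝ, IsClosed {z : ℂ | z ∈ R ∧ z.re = c} := fun c =>
    hRcpt.isClosed.inter (isClosed_eq continuous_re continuous_const)
  have hLside_closed : IsClosed Lside :=
    ((hRcpt.of_isClosed_subset (hside_closed _) fun z hz => hz.1).image_of_continuousOn
      (hgc.mono fun z hz => hz.1)).isClosed
  have hRside_closed : IsClosed Rside :=
    ((hRcpt.of_isClosed_subset (hside_closed _) fun z hz => hz.1).image_of_continuousOn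
      (hgc.mono fun z hz => hz.1)).isClosed
  -- coordinates of image points
  have himg_coord : ∀ z ∈ R, |(g z).re| ≤ 1 - s + η ∧
      |(g z).re - z.re| ≤ η ∧ |(g z).im - z.im| ≤ η := by
    intro z hz
    obtain ⟨h1, h2⟩ := abs_re_sub_le_of_norm_sub_le (hgη z hz)
    obtain ⟨h3, -⟩ := abs_re_le_of_mem_rect hz
    refine ⟨?_, h1, h2⟩
    rw [abs_le] at h1 h3 ⊢
    exact ⟨by linarith [h1.1, h3.1], by linarith [h1.2, h3.2]⟩
  -- the band: points of `K` off `g(R̄ₛ)` are far left or far right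
  have hband : ∀ w ∈ K, w ∉ Rimg → 1 - s - 2 * η < |w.re| := by
    intro w hwK hw
    by_contra hre
    push Not at hre
    refine hw (mem_image_of_norm_sub_le ha hb hgc hgη (show η < 2 * η by linarith) ?_ ?_)
    · linarith
    · linarith [hKim w hwK]
  set LEFT := {z | z ∈ K ∧ z ∉ Rimg ∧ z.re < 0} with hLEFT
  set RIGHT := {z | z ∈ K ∧ z ∉ Rimg ∧ 0 < z.re} with hRIGHT
  have hLEFT_re : ∀ z ∈ LEFT, z.re ≤ -(1 - s - 2 * η) := fun z hz => by
    have := hband z hz.1 hz.2.1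
    rw [abs_of_neg hz.2.2] at this
    linarith
  have hRIGHT_re : ∀ z ∈ RIGHT, 1 - s - 2 * η ≤ z.re := fun z hz => by
    have := hband z hz.1 hz.2.1
    rw [abs_of_pos hz.2.2] at this
    linarith
  have hclLEFT_re : ∀ z ∈ closure LEFT, z.re ≤ -(1 - s - 2 * η) :=
    (isClosed_le continuous_re continuous_const).closure_subset_iff.2 hLEFT_re
  have hclRIGHT_re : ∀ z ∈ closure RIGHT, 1 - s - 2 * η ≤ z.re :=
    (isClosed_le continuous_const continuous_re).closure_subset_iff.2 hRIGHT_re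
  have hclLEFT_K : closure LEFT ⊆ K := hKc.isClosed.closure_subset_iff.2 fun z hz => hz.1
  have hclRIGHT_K : closure RIGHT ⊆ K := hKc.isClosed.closure_subset_iff.2 fun z hz => hz.1
  -- points of `g(R̄ₛ)` in the closure of `LEFT` are on the image of the left side
  have hfront : ∀ z ∈ Rimg, z ∈ closure (Rimgᶜ) → z ∈ K →
      (z.re ≤ -(1 - s - 2 * η) → z ∈ Lside) ∧ (1 - s - 2 * η ≤ z.re → z ∈ Rside) := by
    intro z hz hz' hzK
    obtain ⟨u, hu, rfl⟩ := mem_image_frontier_of_mem_closure_compl ha hb hgc hgi hz hz'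
    have huR : u ∈ R := by
      rw [hR, ← closure_Ioo_reProdIm_Ioo ha hb]
      exact frontier_subset_closure hu
    obtain ⟨-, h3, h4⟩ := himg_coord u huR
    have hKi := hKim _ hzK
    rw [abs_le] at h3 h4 hKi
    rw [mem_frontier_Ioo_reProdIm_Ioo ha hb] at hu
    rcases hu with ⟨-, hu | hu⟩ | ⟨hu | hu, -⟩
    · exfalso; linarith [h4.1, h4.2, hKi.1]
    · exfalso; linarith [h4.1, h4.2, hKi.2]
    · exact ⟨fun _ => ⟨u, ⟨huR, hu⟩, rfl⟩, fun h => by exfalso; linarith [h3.1, h3.2]⟩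
    · exact ⟨fun h => by exfalso; linarith [h3.1, h3.2], fun _ => ⟨u, ⟨huR, hu⟩, rfl⟩⟩
  have hLEFT_sub : LEFT ⊆ Rimgᶜ := fun z hz => hz.2.1
  have hRIGHT_sub : RIGHT ⊆ Rimgᶜ := fun z hz => hz.2.1
  have hclLEFT : ∀ z ∈ closure LEFT, z ∈ Rimg → z ∈ Lside := fun z hz hzR =>
    (hfront z hzR (closure_mono hLEFT_sub hz) (hclLEFT_K hz)).1 (hclLEFT_re z hz)
  have hclRIGHT : ∀ z ∈ closure RIGHT, z ∈ Rimg → z ∈ Rside := fun z hz hzR =>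
    (hfront z hzR (closure_mono hRIGHT_sub hz) (hclRIGHT_K hz)).2 (hclRIGHT_re z hz)
  -- the compact set `Z = K ∩ g(R̄ₛ)`
  set Z := K ∩ Rimg with hZ
  have hZc : IsCompact Z := hKc.inter_right hRimg_closed
  have hZsubK : Z ⊆ K := inter_subset_left
  have hZsubR : Z ⊆ Rimg := inter_subset_right
  by_contra hno
  -- no preconnected subset of `Z` meets both side images
  have hcut : ∀ C ⊆ Z, IsPreconnected C → (C ∩ Lside).Nonempty → (C ∩ Rside).Nonempty →
      False := by
    intro C hCZ hC hCL hCR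
    have hclC : closure C ⊆ Z := hZc.isClosed.closure_subset_iff.2 hCZ
    refine hno ⟨closure C, hclC.trans hZsubK, hKc.of_isClosed_subset isClosed_closure
      (hclC.trans hZsubK), ⟨?_, hC.closure⟩, hclC.trans hZsubR, ?_, ?_⟩
    · obtain ⟨x, hx, -⟩ := hCL
      exact ⟨x, subset_closure hx⟩
    · exact hCL.mono (inter_subset_inter_left _ subset_closure)
    · exact hCR.mono (inter_subset_inter_left _ subset_closure)
  obtain ⟨Z₁, Z₂, hZ₁c, hZ₂c, hZ₁₂, hZunion, hZ₁R, hZ₂L⟩ :=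
    exists_closed_separation hZc hLside_closed hRside_closed hcut
  have hZ₁sub : Z₁ ⊆ Z := hZunion ▸ subset_union_left
  have hZ₂sub : Z₂ ⊆ Z := hZunion ▸ subset_union_right
  have hmemZ : ∀ z ∈ K, z ∈ Rimg → z ∈ Z₁ ∨ z ∈ Z₂ := fun z hzK hzR => by
    have : z ∈ Z₁ ∪ Z₂ := by rw [hZunion]; exact ⟨hzK, hzR⟩
    exact this
  -- the two closed pieces of `K`
  set E₁ := LEFT ∪ Z₁ with hE₁
  set E₂ := RIGHT ∪ Z₂ with hE₂
  have hcover : K ⊆ E₁ ∪ E₂ := by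
    intro z hzK
    by_cases hzR : z ∈ Rimg
    · rcases hmemZ z hzK hzR with h | h
      · exact Or.inl (Or.inr h)
      · exact Or.inr (Or.inr h)
    · have hb' := hband z hzK hzR
      have hpos : (0 : ℝ) < 1 - s - 2 * η := by linarith
      have hne : z.re ≠ 0 := fun h0 => by rw [h0, abs_zero] at hb'; linarith
      rcases lt_or_gt_of_ne hne with hneg | hpos'
      · exact Or.inl (Or.inl ⟨hzK, hzR, hneg⟩)
      · exact Or.inr (Or.inl ⟨hzK, hzR, hpos'⟩)
  have hE₁closed : IsClosed E₁ := by
    refine isClosed_of_closure_subset fun z hz => ?_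
    rw [hE₁, closure_union, hZ₁c.closure_eq] at hz
    rcases hz with hz | hz
    · by_cases hzR : z ∈ Rimg
      · have hzL : z ∈ Lside := hclLEFT z hz hzR
        rcases hmemZ z (hclLEFT_K hz) hzR with h | h
        · exact Or.inr h
        · exact absurd hzL (Set.disjoint_left.1 hZ₂L h)
      · refine Or.inl ⟨hclLEFT_K hz, hzR, ?_⟩
        have := hclLEFT_re z hz
        linarith
    · exact Or.inr hz
  have hE₂closed : IsClosed E₂ := by
    refine isClosed_of_closure_subset fun z hz => ?_
    rw [hE₂, closure_union, hZ₂c.closure_eq] at hz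
    rcases hz with hz | hz
    · by_cases hzR : z ∈ Rimg
      · have hzRs : z ∈ Rside := hclRIGHT z hz hzR
        rcases hmemZ z (hclRIGHT_K hz) hzR with h | h
        · exact absurd hzRs (Set.disjoint_left.1 hZ₁R h)
        · exact Or.inr h
      · refine Or.inl ⟨hclRIGHT_K hz, hzR, ?_⟩
        have := hclRIGHT_re z hz
        linarith
    · exact Or.inr hz
  have hdisjE : Disjoint E₁ E₂ := by
    rw [Set.disjoint_left]
    rintro z (hz | hz) (hz' | hz')
    · linarith [hz.2.2, hz'.2.2]
    · exact hz.2.1 (hZ₂sub hz').2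
    · exact hz'.2.1 (hZ₁sub hz).2
    · exact Set.disjoint_left.1 hZ₁₂ hz hz'
  -- both pieces are nonempty
  have hne₁ : (K ∩ E₁).Nonempty := by
    obtain ⟨w, hwK, hw⟩ := hK₀
    have hwR : w ∉ Rimg := by
      rintro ⟨u, hu, rfl⟩
      have := (himg_coord u hu).1
      rw [abs_le] at this
      linarith [this.1]
    exact ⟨w, hwK, Or.inl ⟨hwK, hwR, by linarith⟩⟩
  have hne₂ : (K ∩ E₂).Nonempty := by
    obtain ⟨w, hwK, hw⟩ := hK₂
    have hwR : w ∉ Rimg := by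
      rintro ⟨u, hu, rfl⟩
      have := (himg_coord u hu).1
      rw [abs_le] at this
      linarith [this.2]
    exact ⟨w, hwK, Or.inl ⟨hwK, hwR, by linarith⟩⟩
  obtain ⟨z, -, hz₁, hz₂⟩ :=
    isPreconnected_closed_iff.1 hKconn.isPreconnected E₁ E₂ hE₁closed hE₂closed hcover hne₁ hne₂
  exact Set.disjoint_left.1 hdisjE hz₁ hz₂

end Literature.Topology.PlaneTopology
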